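import Summits.NavierStokesRegularity.NavierStokesRegularity.Theorems.StrainDoorsFixedDeltaSupTypeI
import Summits.NavierStokesRegularity.NavierStokesRegularity.Theorems.StrainDoorsSlicedLEIUnderRate
import HarnessLib

/-!
# Strain doors, PART M §M31(e) — DOOR X″ CLOSED: `ulocMorreyBoundSupTypeI_holds`

ROUND 70 of the `ns-regularity-ideate` programme (p1 line; helper lane of `stmt-NavierStokesRegularity-0056`,
rung N0; nothing here is a claim about Navier–Stokes regularity).  ROUND 69 proved door X′ (the `L²`-Morrey Type-I
bound from the sup-norm rate IN THE ENERGY CLASS, constant `M₂(M, ‖u₀‖₂, T₀)`) and typed door X″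
`UlocMorreyBoundSupTypeI`: the same bound with an `M`-ONLY constant at all radii `r² < T`.  ROUND 70 CLOSES X″ by a
uniformly-local energy Grönwall argument under the rate, in three links, ALL PROVED: LINK 1 (the pressure pairing of
the local energy inequality is LINEAR in the local energies under a sup bound, `M`-free constants — texts N11a/N11b),
LINK 2 (the sliced local energy inequality under the rate at unit scale is linear with `M`-only data — typed in N11c,
PROVED in N11e/N11f/N11g), LINK 3 (LINK 2 ⇒ X″ by Grönwall and Leray rescaling — N11c); N11d puts them together:
`ulocMorreyBoundSupTypeI_holds : UlocMorreyBoundSupTypeI`.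

THIS FILE (imports ROUND 69's N10c `StrainDoorsFixedDeltaSupTypeI` for the door and N11g): the named reduction
`ulocMorreyBoundSupTypeI_of_slicedLinearLEI : SlicedLinearLEIUnderRate → UlocMorreyBoundSupTypeI` (§M30(c) is literally
the body of the door) and the CLOSING `ulocMorreyBoundSupTypeI_holds : UlocMorreyBoundSupTypeI` (LINK 2 proved in N11g).
Door X (`SliceL3Concentration`, `M`-only `L³` concentration) then needs only the CAPPED form of §M27(b) (radii `r² < T`).
No `sorry`, no new axioms, no instances, no notation, no definitions.
-/

noncomputable section

set_option linter.dupNamespace false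

open MeasureTheory Set Function Filter Metric Real
open _root_.Topology
open scoped ENNReal NNReal RealInnerProductSpace
open Literature.Analysis Literature.Analysis.FluidPDE

namespace Summit.NavierStokesRegularity.NavierStokesRegularity.Theorems.StrainDoors

/-! ### §M31(e) Door X″ closed -/

/-- **LINK 2 ⇒ door X″** (`UlocMorreyBoundSupTypeI` of ROUND 69 §M28(i)), by name: the sliced linear local energy
inequality under the Type-I rate at unit scale implies the `M`-only uniformly local Morrey bound at all radii
`r² < T`. [cite: BarkerPrange2020, Theorem 2 and p. 5] -/
theorem ulocMorreyBoundSupTypeI_of_slicedLinearLEI (hLink : SlicedLinearLEIUnderRate) :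
    UlocMorreyBoundSupTypeI :=
  ulocMorreyBound_of_slicedLinearLEI hLink

/-- ★★★ **DOOR X″ CLOSED.**  For every `M` there is `K = K(M)` such that every classical Leray–Hopf solution of the
unit-viscosity unforced Navier–Stokes system on `[0,T)` with the sup-norm Type-I rate `|u(t,x)| ≤ M/√(T − t)` obeys the
uniformly local Morrey bound `∫_{B(y,r)} |u(t,x)|² dx ≤ K r` for all `y`, all radii `0 < r`, `r² < T` and all
`t ∈ (T − r², T)` — the constant depends on `M` ALONE (not on `‖u₀‖₂`, not on `T`).  In print the passage from the
sup-norm rate to the Morrey-type bound carries a constant depending on the solution through its datum and a radius cap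
(Barker–Prange 2020 p. 5 after Seregin–Zajączkowski 2007 / Seregin 2018); here `K(M) = A(M₊²+M₊³)e^{B₁+2B₂M₊}` with
absolute `A, B₁, B₂` from the linear local energy inequality of §M29–§M31.
[cite: BarkerPrange2020, Theorem 2 and p. 5] -/
theorem ulocMorreyBoundSupTypeI_holds : UlocMorreyBoundSupTypeI :=
  ulocMorreyBound_of_slicedLinearLEI slicedLinearLEIUnderRate_holds


end Summit.NavierStokesRegularity.NavierStokesRegularity.Theorems.StrainDoors

end
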